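import Mathlib
import HarnessLib
import Summits.NavierStokesRegularity.NavierStokesRegularity.Theorems.TypeILiouvilleLambTailExpDecay
import Literature.Analysis.FluidPDE.PoissonGradientSupBound

/-!
# TypeILiouvilleLambTailPolynomial — crux (L) stmt-NavierStokesRegularity-10661 `TypeIliouvilleL`:
# THE FIRST RATE-BEARING GRADIENT DIAL ON PRINT'S CLASS, AND THE POLYNOMIAL CELLS IT BUYS
# (part 8 of `TypeILiouvilleLambTail`; unconditional)

Helper for stmt-NavierStokesRegularity-10661 (`--supports`); theorems only, no definitions, no named-fact
hypotheses; closes no item; Navier–Stokes regularity is NOT proved here (leafhand seat of the EulerZoomLiouville route).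

Class P (`‖v‖ ≤ K` on `(−∞,0) × ℝ³`, continuous, weakly divergence free, Oseen-mild), `ω = curl v`, vortex commutator
`f = Dv[ω] − Dω[v] = curl(v × ω)` as in parts 1–7.  Parts 2/5 closed the SUMMABLE (⟹ quiescent) and EXPONENTIAL
(⟹ constant) Lamb tails; parts 4/7 located the residual L_Q at the RATE-FREE dials (`sup‖ω‖ → 0` ⟺ `sup‖∇v‖ → 0` ⟺
quiescent, by compactness).  Missing for POLYNOMIAL tails was a QUANTITATIVE conversion of vorticity smallness into
gradient smallness on the bounded class (no Biot–Savart law there).  It is supplied by the tree's pointwise interior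
gradient estimate for divergence-free fields (`Literature.Analysis.FluidPDE.exists_opNorm_fderiv_le_of_isDivFree`,
Gilbarg–Trudinger (3.16) via the fixed-scale Green representation: `‖Dv(x)‖ ≤ C (K/r + r sup‖Dω‖)`, every `r > 0`)
and Landau's inequality on the vorticity slices (`sup‖Dω‖ ≤ 4 sup‖ω‖/s + s D₂`, every `s > 0`):

* `classP_norm_fderiv_curl_le_of_curl_le` — Landau dial on `ω`: `‖Dω(τ,y)‖ ≤ 4Ω/s + s D₂` whenever `‖ω(τ,·)‖ ≤ Ω`.
* `classP_norm_fderiv_le_of_fderiv_curl_le` — ★ Poisson dial on `v`: `‖Dv(τ,x)‖ ≤ C (K/r + r B)` whenever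
  `‖Dω(τ,·)‖ ≤ B`; hence (`classP_norm_fderiv_le_rpow_quarter`) ★ **THE QUARTER-POWER GRADIENT DIAL**
  `sup_x ‖∇v(τ,x)‖ ≤ C_v · Ω^{1/4}` whenever `sup_x ‖ω(τ,x)‖ ≤ Ω ≤ 1` — the first gradient-by-vorticity bound WITH A RATE
  on print's class in the tree (parts 4/7 and `TypeILiouvilleQuiescentVorticity` are rate-free).
* `const_of_vorticity_polynomial_decay` — ★★ **POLYNOMIALLY FADING VORTICITY ⟹ ONE CONSTANT VECTOR**: a class-P flow
  with `‖ω(τ,x)‖ ≤ M (−τ)^{−β}` on `(−∞,0) × ℝ³` for some `β > 4` is constant (gradient majorant `≍ (1−τ)^{−β/4}`,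
  integrable at `−∞`; then `TypeILiouvilleStrainLedger.const_of_integrable_gradient_tail`).
* `const_of_commutator_polynomial_decay`, `const_of_lambCurl_polynomial_decay` — ★★ **POLYNOMIALLY ASYMPTOTICALLY
  BELTRAMI ⟹ ONE CONSTANT VECTOR**: `‖curl(v × ω)(τ,x)‖ ≤ A (−τ)^{−p}` for some `p > 5` ⟹ constant (Lamb-tail budget of
  part 2 gives `‖ω(t)‖ ≤ A (p−1)^{−1} (1−t)^{1−p}` for the time-shifted flow, then the previous theorem with `β = p − 1`).

READING for the residual of (L): the POLYNOMIAL stratum `p > 5` is EMPTY of non-constant flows (the vortex commutator of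
a non-constant class-P member is not `O((−τ)^{−5−ε})`, its vorticity not `O((−τ)^{−4−ε})`); the thresholds `4`, `5` are
artefacts of the two square roots (Landau, Poisson) — a log-Lipschitz dial would give `1`, `2`.
HONEST LABEL: classical estimates on print's class; nothing here proves a registered stub, (L), or Navier–Stokes
regularity; rung 0.
[cite: KochNadirashviliSereginSverak2009, §4 (i), Lemma 6.1 (arXiv:0709.3599)] [cite: GilbargTrudinger2001, Thm. 3.9 / (3.16)]
[cite: MajdaBertozziCUP2002, eq. (3.80), §2.3]
-/

noncomputable section
open MeasureTheory Filter Set Function Metric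
open scoped Topology ENNReal RealInnerProductSpace Laplacian ContDiff
open Literature.Analysis Literature.Analysis.FluidPDE Literature.Analysis.UnboundedOperators
set_option linter.dupNamespace false
namespace Summit.NavierStokesRegularity.NavierStokesRegularity.Theorems.TypeILiouvilleLambTail

/-! ## §1 The two quantitative dials on print's class -/

/-- **Landau dial on the vorticity (class P).**  There is `D₂ ≥ 0` (the uniform `C²` bound of the vorticity slices)
such that on every slice `τ < 0` with `sup_y ‖ω(τ,y)‖ ≤ Ω`: `‖Dω(τ,y)‖ ≤ 4Ω/s + s D₂` for every `s > 0`
(Landau's inequality `TypeILiouvilleQuiescentGradient.norm_fderiv_le_of_osc` with the global oscillation `2Ω`).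
[cite: KochNadirashviliSereginSverak2009, §4 (arXiv:0709.3599)] -/
theorem classP_norm_fderiv_curl_le_of_curl_le
    {v : ℝ → EuclideanSpace ℝ (Fin 3) → EuclideanSpace ℝ (Fin 3)}
    (hc : ContinuousOn (uncurry v) (Iio 0 ×ˢ univ))
    (hK : ∃ K : ℝ, ∀ t < 0, ∀ x, ‖v t x‖ ≤ K)
    (hd : ∀ t < 0, IsWeaklyDivFree (v t))
    (hm : ∀ s t : ℝ, s < t → t < 0 → ∀ x,
      v t x = heatExtension (v s) (t - s) x - oseenDuhamel 1 s v v t x) :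
    ∃ D₂ : ℝ, 0 ≤ D₂ ∧ ∀ τ < 0, ∀ Ω : ℝ, (∀ y, ‖curl (v τ) y‖ ≤ Ω) →
      ∀ s : ℝ, 0 < s → ∀ y, ‖fderiv ℝ (curl (v τ)) y‖ ≤ 4 * Ω / s + s * D₂ := by
  obtain ⟨K, hKb⟩ := hK
  obtain ⟨hsm', -⟩ := smooth_and_bounds_of_bounded_ancient_oseenMild hc hd hm hKb
  have hsm : IsSmoothSpaceTimeOn (Iio 0) v := hsm'
  have hvort : IsSmoothSpaceTimeOn (Iio 0) (vorticity v) := isSmoothSpaceTimeOn_vorticity_Iio hsm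
  obtain ⟨D₂, hD₂⟩ := classP_norm_iteratedFDeriv_curl_le hc ⟨K, hKb⟩ hd hm 2
  have hD₂0 : 0 ≤ D₂ := (norm_nonneg _).trans (hD₂ (-1) (by norm_num) 0)
  refine ⟨D₂, hD₂0, fun τ hτ Ω hΩ s hs y => ?_⟩
  have hf : ContDiff ℝ ∞ (curl (v τ)) := hvort.contDiff_slice (mem_Iio.2 hτ)
  have hosc : ∀ z ∈ ball y (s + 1), ‖curl (v τ) z - curl (v τ) y‖ ≤ 2 * Ω := fun z _ =>
    (norm_sub_le _ _).trans (by linarith [hΩ z, hΩ y])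
  have h := TypeILiouvilleQuiescentGradient.norm_fderiv_le_of_osc hf hD₂0 (hD₂ τ hτ) hosc hs (by linarith)
  calc ‖fderiv ℝ (curl (v τ)) y‖ ≤ 2 * (2 * Ω) / s + s * D₂ := h
    _ = 4 * Ω / s + s * D₂ := by ring

/-- ★ **Poisson dial on the velocity (class P).**  With `‖v‖ ≤ K`: there is an absolute `C > 0` such that on every slice
`τ < 0` with `sup_y ‖Dω(τ,y)‖ ≤ B`: `‖Dv(τ,x)‖ ≤ C (K/r + r B)` for every `r > 0` — the tree's pointwise interior
gradient estimate for divergence-free fields (`Δv = −curl ω`), on the smooth, classically divergence-free slices.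
[cite: GilbargTrudinger2001, Thm. 3.9 / (3.16)] [cite: KochNadirashviliSereginSverak2009, §4 (arXiv:0709.3599)] -/
theorem classP_norm_fderiv_le_of_fderiv_curl_le
    {v : ℝ → EuclideanSpace ℝ (Fin 3) → EuclideanSpace ℝ (Fin 3)}
    (hc : ContinuousOn (uncurry v) (Iio 0 ×ˢ univ))
    {K : ℝ} (hKb : ∀ t < 0, ∀ x, ‖v t x‖ ≤ K)
    (hd : ∀ t < 0, IsWeaklyDivFree (v t))
    (hm : ∀ s t : ℝ, s < t → t < 0 → ∀ x,
      v t x = heatExtension (v s) (t - s) x - oseenDuhamel 1 s v v t x) :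
    ∃ C : ℝ, 0 < C ∧ ∀ τ < 0, ∀ B : ℝ, (∀ y, ‖fderiv ℝ (curl (v τ)) y‖ ≤ B) →
      ∀ r : ℝ, 0 < r → ∀ x, ‖fderiv ℝ (v τ) x‖ ≤ C * (K / r + r * B) := by
  obtain ⟨hsm', -⟩ := smooth_and_bounds_of_bounded_ancient_oseenMild hc hd hm hKb
  have hsm : IsSmoothSpaceTimeOn (Iio 0) v := hsm'
  obtain ⟨C, hC, hCv⟩ := exists_opNorm_fderiv_le_of_isDivFree
  refine ⟨C, hC, fun τ hτ B hB r hr x => ?_⟩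
  have hvs : ContDiff ℝ ∞ (v τ) := hsm.contDiff_slice (mem_Iio.2 hτ)
  have hv3 : ContDiff ℝ 3 (v τ) := hvs.of_le (by norm_cast)
  have hdiv : VectorCalculus.IsDivFree (v τ) :=
    (hd τ hτ).isDivFree_of_contDiff (hvs.of_le (by norm_cast))
  exact hCv (v τ) x r K B hv3 hdiv hr (fun y _ => hKb τ hτ y) (fun y _ => hB y)

/-- ★ **THE QUARTER-POWER GRADIENT DIAL (class P).**  There is `C_v ≥ 0` such that on every slice `τ < 0`:
`sup_y ‖ω(τ,y)‖ ≤ Ω ≤ 1 ⟹ sup_x ‖∇v(τ,x)‖ ≤ C_v Ω^{1/4}` (Landau scale `s = Ω^{1/2}`, Poisson scale `r = Ω^{−1/4}`).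
The first gradient-by-vorticity bound WITH A RATE on print's class in the tree.
[cite: GilbargTrudinger2001, Thm. 3.9 / (3.16)] [cite: KochNadirashviliSereginSverak2009, §4 (arXiv:0709.3599)] -/
theorem classP_norm_fderiv_le_rpow_quarter
    {v : ℝ → EuclideanSpace ℝ (Fin 3) → EuclideanSpace ℝ (Fin 3)}
    (hc : ContinuousOn (uncurry v) (Iio 0 ×ˢ univ))
    (hK : ∃ K : ℝ, ∀ t < 0, ∀ x, ‖v t x‖ ≤ K)
    (hd : ∀ t < 0, IsWeaklyDivFree (v t))
    (hm : ∀ s t : ℝ, s < t → t < 0 → ∀ x,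
      v t x = heatExtension (v s) (t - s) x - oseenDuhamel 1 s v v t x) :
    ∃ Cv : ℝ, 0 ≤ Cv ∧ ∀ τ < 0, ∀ Ω : ℝ, 0 < Ω → Ω ≤ 1 → (∀ y, ‖curl (v τ) y‖ ≤ Ω) →
      ∀ x, ‖fderiv ℝ (v τ) x‖ ≤ Cv * Ω ^ (1 / 4 : ℝ) := by
  obtain ⟨K, hKb⟩ := hK
  have hK0 : 0 ≤ K := (norm_nonneg _).trans (hKb (-1) (by norm_num) 0)
  obtain ⟨D₂, hD₂0, hL⟩ := classP_norm_fderiv_curl_le_of_curl_le hc ⟨K, hKb⟩ hd hm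
  obtain ⟨C, hC, hP⟩ := classP_norm_fderiv_le_of_fderiv_curl_le hc hKb hd hm
  refine ⟨C * (K + 4 + D₂), by positivity, fun τ hτ Ω hΩ hΩ1 hω x => ?_⟩
  -- Landau scale `s = Ω^{1/2}`: `‖Dω‖ ≤ (4 + D₂) Ω^{1/2}`
  have hs : 0 < Ω ^ (1 / 2 : ℝ) := Real.rpow_pos_of_pos hΩ _
  have hB : ∀ y, ‖fderiv ℝ (curl (v τ)) y‖ ≤ (4 + D₂) * Ω ^ (1 / 2 : ℝ) := by
    intro y
    have h := hL τ hτ Ω hω (Ω ^ (1 / 2 : ℝ)) hs y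
    have h1 : 4 * Ω / Ω ^ (1 / 2 : ℝ) = 4 * Ω ^ (1 / 2 : ℝ) := by
      rw [mul_div_assoc]
      congr 1
      rw [div_eq_iff hs.ne', ← Real.rpow_add hΩ]
      norm_num
    calc ‖fderiv ℝ (curl (v τ)) y‖ ≤ 4 * Ω / Ω ^ (1 / 2 : ℝ) + Ω ^ (1 / 2 : ℝ) * D₂ := h
      _ = (4 + D₂) * Ω ^ (1 / 2 : ℝ) := by rw [h1]; ring
  -- Poisson scale `r = Ω^{-1/4}`
  have hr : 0 < Ω ^ (-(1 / 4 : ℝ)) := Real.rpow_pos_of_pos hΩ _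
  have h := hP τ hτ _ hB (Ω ^ (-(1 / 4 : ℝ))) hr x
  have h3 : K / Ω ^ (-(1 / 4 : ℝ)) = K * Ω ^ (1 / 4 : ℝ) := by
    rw [Real.rpow_neg hΩ.le, div_inv_eq_mul]
  have h4 : Ω ^ (-(1 / 4 : ℝ)) * ((4 + D₂) * Ω ^ (1 / 2 : ℝ)) = (4 + D₂) * Ω ^ (1 / 4 : ℝ) := by
    have : Ω ^ (-(1 / 4 : ℝ)) * Ω ^ (1 / 2 : ℝ) = Ω ^ (1 / 4 : ℝ) := by
      rw [← Real.rpow_add hΩ]; norm_num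
    rw [← this]; ring
  calc ‖fderiv ℝ (v τ) x‖ ≤ C * (K / Ω ^ (-(1 / 4 : ℝ)) + Ω ^ (-(1 / 4 : ℝ)) * ((4 + D₂) * Ω ^ (1 / 2 : ℝ))) := h
    _ = C * (K + 4 + D₂) * Ω ^ (1 / 4 : ℝ) := by rw [h3, h4]; ring

/-! ## §2 Calculus of the majorant `(1 − τ)^{−q}` -/

/-- `τ ↦ (1 − τ)^{−q}` is integrable on `(−∞, −1]` for `q > 1` (compare with `u^{−q}` on `[1, ∞)`, `u = −τ`). [folklore] -/
theorem integrableOn_one_sub_rpow_neg_Iic {q : ℝ} (hq : 1 < q) :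
    IntegrableOn (fun τ : ℝ => (1 - τ) ^ (-q)) (Iic (-1)) := by
  have h1 : IntegrableOn (fun u : ℝ => u ^ (-q)) (Ioi (1 / 2)) :=
    integrableOn_Ioi_rpow_of_lt (by linarith) (by norm_num)
  have h1' : IntegrableOn (fun u : ℝ => u ^ (-q)) (Ici 1) :=
    h1.mono_set fun u hu => by
      have hu1 : (1 : ℝ) ≤ u := mem_Ici.1 hu
      simp only [mem_Ioi]; linarith
  have hmeas : AEStronglyMeasurable (fun u : ℝ => (1 + u) ^ (-q)) (volume.restrict (Ici 1)) := by
    have hcont : ContinuousOn (fun u : ℝ => (1 + u) ^ (-q)) (Ici 1) :=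
      ContinuousOn.rpow_const (by fun_prop) fun u hu => Or.inl (by
        have hu1 : (1 : ℝ) ≤ u := mem_Ici.1 hu
        linarith)
    exact hcont.aestronglyMeasurable measurableSet_Ici
  have h2 : IntegrableOn (fun u : ℝ => (1 + u) ^ (-q)) (Ici (-(-1 : ℝ))) := by
    rw [neg_neg]
    refine Integrable.mono' h1' hmeas ?_
    refine ae_restrict_of_forall_mem measurableSet_Ici fun u hu => ?_
    have hu1 : (1 : ℝ) ≤ u := mem_Ici.1 hu
    rw [Real.norm_of_nonneg (Real.rpow_nonneg (by linarith) _)]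
    exact Real.rpow_le_rpow_of_nonpos (by linarith) (by linarith) (by linarith)
  have h3 : IntegrableOn (fun x : ℝ => (1 + -x) ^ (-q)) (Iic (-1)) := h2.comp_neg_Iic
  exact h3.congr_fun (fun x _ => by simp only [sub_eq_add_neg]) measurableSet_Iic

/-- `τ ↦ (1 − τ)^{−q}` is integrable on `(−∞, t]` for `q > 1`, `t ≤ 0`. [folklore] -/
theorem integrableOn_one_sub_rpow_neg_Iic_of_nonpos {q : ℝ} (hq : 1 < q) {t : ℝ} (ht : t ≤ 0) :
    IntegrableOn (fun τ : ℝ => (1 - τ) ^ (-q)) (Iic t) := by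
  have hcont : ContinuousOn (fun τ : ℝ => (1 - τ) ^ (-q)) (Icc (-1) 0) :=
    ContinuousOn.rpow_const (by fun_prop) fun τ hτ => Or.inl (by linarith [hτ.2])
  have hun : Iic t ⊆ Iic (-1) ∪ Icc (-1) 0 := fun τ hτ => by
    have hτt : τ ≤ t := mem_Iic.1 hτ
    rcases le_or_gt τ (-1) with h | h
    · exact Or.inl h
    · exact Or.inr ⟨h.le, hτt.trans ht⟩
  exact ((integrableOn_one_sub_rpow_neg_Iic hq).union hcont.integrableOn_Icc).mono_set hun

/-- `∫_{(−∞,t]} A (1 − τ)^{−q} dτ = A (1 − t)^{1−q} / (q − 1)` for `q > 1`, `t ≤ 0` (FTC on a half-line; the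
antiderivative `A (1 − τ)^{1−q}/(q − 1)` tends to `0` at `−∞`). [folklore] -/
theorem integral_Iic_one_sub_rpow_neg {q : ℝ} (hq : 1 < q) {t : ℝ} (ht : t ≤ 0) (A : ℝ) :
    ∫ τ in Iic t, A * (1 - τ) ^ (-q) = A * (1 - t) ^ (1 - q) / (q - 1) := by
  have hq1 : q - 1 ≠ 0 := by linarith
  -- antiderivative
  have hderiv : ∀ τ ∈ Iic t, HasDerivAt (fun r : ℝ => A * (1 - r) ^ (1 - q) / (q - 1)) (A * (1 - τ) ^ (-q)) τ := by
    intro τ hτ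
    have hτt : τ ≤ t := mem_Iic.1 hτ
    have hτ1 : 0 < 1 - τ := by linarith
    have h1 : HasDerivAt (fun r : ℝ => 1 - r) (-1) τ := (hasDerivAt_id τ).const_sub 1
    have h2 := h1.rpow_const (p := 1 - q) (Or.inl hτ1.ne')
    have h3 := (h2.const_mul A).div_const (q - 1)
    refine h3.congr_deriv ?_
    rw [show (1 - q - 1 : ℝ) = -q by ring]
    field_simp
    ring
  have hint : IntegrableOn (fun τ : ℝ => A * (1 - τ) ^ (-q)) (Iic t) :=
    (integrableOn_one_sub_rpow_neg_Iic_of_nonpos hq ht).const_mul A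
  have h1 : Tendsto (fun r : ℝ => 1 - r) atBot atTop := by
    simpa [sub_eq_add_neg] using tendsto_atTop_add_const_left atBot (1 : ℝ) tendsto_neg_atBot_atTop
  have h2 : Tendsto (fun r : ℝ => (1 - r) ^ (1 - q)) atBot (𝓝 0) :=
    ((tendsto_rpow_neg_atTop (y := q - 1) (by linarith)).comp h1).congr fun r => by
      simp only [Function.comp_apply, neg_sub]
  have hlim : Tendsto (fun r : ℝ => A * (1 - r) ^ (1 - q) / (q - 1)) atBot (𝓝 (A * 0 / (q - 1))) :=
    (h2.const_mul A).div_const _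
  rw [mul_zero, zero_div] at hlim
  rw [integral_Iic_of_hasDerivAt_of_tendsto' hderiv hint hlim, sub_zero]

/-! ## §3 Polynomially fading vorticity ⟹ one constant vector -/

/-- **Shifted form.**  A class-P flow with `‖ω(τ,x)‖ ≤ M (1 − τ)^{−β}` on `(−∞,0) × ℝ³` for some `β > 4` is one constant
vector: Landau scale `s = (1−τ)^{−β/2}` gives `‖Dω(τ,·)‖ ≤ (4M + D₂)(1−τ)^{−β/2}`, Poisson scale `r = (1−τ)^{β/4}`
gives `‖Dv(τ,·)‖ ≤ C (K + 4M + D₂)(1−τ)^{−β/4}`, an integrable gradient tail; then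
`TypeILiouvilleStrainLedger.const_of_integrable_gradient_tail`.
[cite: GilbargTrudinger2001, Thm. 3.9 / (3.16)] [cite: MajdaBertozziCUP2002, eq. (3.80)]
[cite: KochNadirashviliSereginSverak2009, §4 (i) (arXiv:0709.3599)] -/
theorem const_of_vorticity_polynomial_decay_shifted
    {v : ℝ → EuclideanSpace ℝ (Fin 3) → EuclideanSpace ℝ (Fin 3)}
    (hc : ContinuousOn (uncurry v) (Iio 0 ×ˢ univ))
    (hK : ∃ K : ℝ, ∀ t < 0, ∀ x, ‖v t x‖ ≤ K)
    (hd : ∀ t < 0, IsWeaklyDivFree (v t))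
    (hm : ∀ s t : ℝ, s < t → t < 0 → ∀ x,
      v t x = heatExtension (v s) (t - s) x - oseenDuhamel 1 s v v t x)
    {β M : ℝ} (hβ : 4 < β)
    (hω : ∀ τ < 0, ∀ x : EuclideanSpace ℝ (Fin 3), ‖curl (v τ) x‖ ≤ M * (1 - τ) ^ (-β)) :
    ∃ b : EuclideanSpace ℝ (Fin 3), ∀ t < 0, ∀ x, v t x = b := by
  obtain ⟨K, hKb⟩ := hK
  have hK0 : 0 ≤ K := (norm_nonneg _).trans (hKb (-1) (by norm_num) 0)
  have hM0 : 0 ≤ M := by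
    have h := (norm_nonneg _).trans (hω (-1) (by norm_num) 0)
    have h1 : (0 : ℝ) < (1 - (-1 : ℝ)) ^ (-β) := Real.rpow_pos_of_pos (by norm_num) _
    exact nonneg_of_mul_nonneg_left h h1
  obtain ⟨D₂, hD₂0, hL⟩ := classP_norm_fderiv_curl_le_of_curl_le hc ⟨K, hKb⟩ hd hm
  obtain ⟨C, hC, hP⟩ := classP_norm_fderiv_le_of_fderiv_curl_le hc hKb hd hm
  -- the gradient majorant
  set A₀ : ℝ := C * (K + 4 * M + D₂) with hA₀
  set g : ℝ → ℝ := fun τ => A₀ * (max (1 - τ) 1) ^ (-(β / 4)) with hg_def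
  have hgc : Continuous g := by
    refine continuous_const.mul (Continuous.rpow_const (by fun_prop) fun τ => Or.inl ?_)
    exact (lt_of_lt_of_le one_pos (le_max_right _ _)).ne'
  have hg_eq : ∀ τ < 0, g τ = A₀ * (1 - τ) ^ (-(β / 4)) := fun τ hτ => by simp [hg_def, max_eq_left (by linarith : (1 : ℝ) ≤ 1 - τ)]
  -- the gradient bound on every slice
  have hgrad : ∀ τ < 0, ∀ x : EuclideanSpace ℝ (Fin 3), ‖fderiv ℝ (v τ) x‖ ≤ g τ := by
    intro τ hτ x
    have h1τ : 0 < 1 - τ := by linarith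
    -- Landau at scale `s = (1-τ)^{-β/2}`
    have hs : 0 < (1 - τ) ^ (-(β / 2)) := Real.rpow_pos_of_pos h1τ _
    have hB : ∀ y, ‖fderiv ℝ (curl (v τ)) y‖ ≤ (4 * M + D₂) * (1 - τ) ^ (-(β / 2)) := by
      intro y
      have h := hL τ hτ (M * (1 - τ) ^ (-β)) (hω τ hτ) _ hs y
      have h1 : 4 * (M * (1 - τ) ^ (-β)) / (1 - τ) ^ (-(β / 2)) = 4 * M * (1 - τ) ^ (-(β / 2)) := by
        rw [div_eq_iff hs.ne', mul_assoc (4 * M), ← Real.rpow_add h1τ]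
        ring_nf
      calc ‖fderiv ℝ (curl (v τ)) y‖ ≤ 4 * (M * (1 - τ) ^ (-β)) / (1 - τ) ^ (-(β / 2)) + (1 - τ) ^ (-(β / 2)) * D₂ := h
        _ = (4 * M + D₂) * (1 - τ) ^ (-(β / 2)) := by rw [h1]; ring
    -- Poisson at scale `r = (1-τ)^{β/4}`
    have hr : 0 < (1 - τ) ^ (β / 4) := Real.rpow_pos_of_pos h1τ _
    have h := hP τ hτ _ hB _ hr x
    have h3 : K / (1 - τ) ^ (β / 4) = K * (1 - τ) ^ (-(β / 4)) := by
      rw [Real.rpow_neg h1τ.le, div_eq_mul_inv]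
    have h4 : (1 - τ) ^ (β / 4) * ((4 * M + D₂) * (1 - τ) ^ (-(β / 2))) = (4 * M + D₂) * (1 - τ) ^ (-(β / 4)) := by
      have : (1 - τ) ^ (β / 4) * (1 - τ) ^ (-(β / 2)) = (1 - τ) ^ (-(β / 4)) := by
        rw [← Real.rpow_add h1τ]; ring_nf
      rw [← this]; ring
    rw [hg_eq τ hτ, hA₀]
    calc ‖fderiv ℝ (v τ) x‖ ≤ C * (K / (1 - τ) ^ (β / 4) + (1 - τ) ^ (β / 4) * ((4 * M + D₂) * (1 - τ) ^ (-(β / 2)))) := h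
      _ = C * (K + 4 * M + D₂) * (1 - τ) ^ (-(β / 4)) := by rw [h3, h4]; ring
  -- integrability of the tail on `(−∞, −1]`
  have hint : IntegrableOn g (Iic (-1)) := by
    have h : IntegrableOn (fun τ : ℝ => A₀ * (1 - τ) ^ (-(β / 4))) (Iic (-1)) :=
      (integrableOn_one_sub_rpow_neg_Iic (q := β / 4) (by linarith)).const_mul A₀
    exact IntegrableOn.congr_fun h (fun τ hτ => (hg_eq τ (by
      have : τ ≤ -1 := mem_Iic.1 hτ
      linarith)).symm) measurableSet_Iic
  exact TypeILiouvilleStrainLedger.const_of_integrable_gradient_tail hc ⟨K, hKb⟩ hd hm hgc hgrad hint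

/-- ★★ **POLYNOMIALLY FADING VORTICITY ⟹ ONE CONSTANT VECTOR (unconditional).**  A class-P flow with
`‖ω(τ,x)‖ ≤ M (−τ)^{−β}` on `(−∞,0) × ℝ³` for some `β > 4` is constant (the time-shifted flow `t ↦ v(t − 1)` is in the
shifted form, `TypeILiouvilleStrainLedger.classP_timeShift`; constant below `−1` ⟹ constant,
`TypeILiouvilleStrainLedger.classP_const_of_const_below`).  Invariant under the Navier–Stokes scaling
(`M ↦ λ^{2−2β} M`).  Compare `TypeILiouvilleQuiescentVorticity.quiescent_of_curl_fading` (ANY fading ⟹ quiescent,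
rate-free) and `TypeILiouvilleStrainLedger.const_of_stretching_lt_vorticity_decay` (needs a stretching hypothesis).
[cite: GilbargTrudinger2001, Thm. 3.9 / (3.16)] [cite: KochNadirashviliSereginSverak2009, §4 (i) (arXiv:0709.3599)] -/
theorem const_of_vorticity_polynomial_decay
    {v : ℝ → EuclideanSpace ℝ (Fin 3) → EuclideanSpace ℝ (Fin 3)}
    (hc : ContinuousOn (uncurry v) (Iio 0 ×ˢ univ))
    (hK : ∃ K : ℝ, ∀ t < 0, ∀ x, ‖v t x‖ ≤ K)
    (hd : ∀ t < 0, IsWeaklyDivFree (v t))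
    (hm : ∀ s t : ℝ, s < t → t < 0 → ∀ x,
      v t x = heatExtension (v s) (t - s) x - oseenDuhamel 1 s v v t x)
    {β M : ℝ} (hβ : 4 < β)
    (hω : ∀ τ < 0, ∀ x : EuclideanSpace ℝ (Fin 3), ‖curl (v τ) x‖ ≤ M * (-τ) ^ (-β)) :
    ∃ b : EuclideanSpace ℝ (Fin 3), ∀ t < 0, ∀ x, v t x = b := by
  obtain ⟨hwc, hwK, hwd, hwm⟩ := TypeILiouvilleStrainLedger.classP_timeShift hc hK hd hm
    (T := -1) (by norm_num)
  have hwω : ∀ τ < 0, ∀ x : EuclideanSpace ℝ (Fin 3),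
      ‖curl ((fun t x => v (t + -1) x) τ) x‖ ≤ M * (1 - τ) ^ (-β) := by
    intro τ hτ x
    have h := hω (τ + -1) (by linarith) x
    rwa [show -(τ + -1) = 1 - τ by ring] at h
  obtain ⟨b, hb⟩ := const_of_vorticity_polynomial_decay_shifted hwc hwK hwd hwm hβ hwω
  have hb' : ∀ τ < -1, ∀ x, v τ x = b := fun τ hτ x => by
    have h := hb (τ + 1) (by linarith) x
    simp only [show τ + 1 + -1 = τ by ring] at h
    exact h
  exact ⟨b, TypeILiouvilleStrainLedger.classP_const_of_const_below hc hK hm hb'⟩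

/-! ## §4 Polynomially asymptotically Beltrami ⟹ one constant vector -/

/-- ★★ **POLYNOMIALLY ASYMPTOTICALLY BELTRAMI ⟹ ONE CONSTANT VECTOR (unconditional).**  A class-P flow whose vortex
commutator satisfies `‖Dv[ω] − Dω[v]‖(τ,x) ≤ A (−τ)^{−p}` on `(−∞,0) × ℝ³` for some `p > 5` is constant: for the
time-shifted flow `w(t) = v(t − 1)` the Lamb-tail budget (part 2, `norm_curl_le_integral_Iic_of_commutator_majorant`,
majorant `A (1−τ)^{−p}`) gives `‖ω_w(t,x)‖ ≤ A (p−1)^{−1} (1−t)^{1−p}`, and §3 applies with `β = p − 1 > 4`.  Invariant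
under the Navier–Stokes scaling (`A ↦ λ^{4−2p} A`).  Parts 2/5: summable ⟹ quiescent, exponential ⟹ constant; this
is the first POLYNOMIAL Lamb-tail cell. [cite: KochNadirashviliSereginSverak2009, §4 (i), Lemma 6.1 (arXiv:0709.3599)]
[cite: GilbargTrudinger2001, Thm. 3.9 / (3.16)] [cite: MajdaBertozziCUP2002, eq. (3.80)] -/
theorem const_of_commutator_polynomial_decay
    {v : ℝ → EuclideanSpace ℝ (Fin 3) → EuclideanSpace ℝ (Fin 3)}
    (hc : ContinuousOn (uncurry v) (Iio 0 ×ˢ univ))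
    (hK : ∃ K : ℝ, ∀ t < 0, ∀ x, ‖v t x‖ ≤ K)
    (hd : ∀ t < 0, IsWeaklyDivFree (v t))
    (hm : ∀ s t : ℝ, s < t → t < 0 → ∀ x,
      v t x = heatExtension (v s) (t - s) x - oseenDuhamel 1 s v v t x)
    {p A : ℝ} (hp : 5 < p)
    (hA : ∀ τ < 0, ∀ x : EuclideanSpace ℝ (Fin 3),
      ‖fderiv ℝ (v τ) x (curl (v τ) x) - fderiv ℝ (curl (v τ)) x (v τ x)‖ ≤ A * (-τ) ^ (-p)) :
    ∃ b : EuclideanSpace ℝ (Fin 3), ∀ t < 0, ∀ x, v t x = b := by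
  obtain ⟨hwc, hwK, hwd, hwm⟩ := TypeILiouvilleStrainLedger.classP_timeShift hc hK hd hm
    (T := -1) (by norm_num)
  -- the continuous majorant `φ τ = A (max (1-τ) 1)^{-p}` of the shifted commutator
  set φ : ℝ → ℝ := fun τ => A * (max (1 - τ) 1) ^ (-p) with hφ_def
  have hφc : Continuous φ := by
    refine continuous_const.mul (Continuous.rpow_const (by fun_prop) fun τ => Or.inl ?_)
    exact (lt_of_lt_of_le one_pos (le_max_right _ _)).ne'
  have hφ_eq : ∀ τ ≤ 0, φ τ = A * (1 - τ) ^ (-p) := fun τ hτ => by simp [hφ_def, max_eq_left (by linarith : (1 : ℝ) ≤ 1 - τ)]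
  have hφ : ∀ τ < 0, ∀ x : EuclideanSpace ℝ (Fin 3),
      ‖fderiv ℝ ((fun t x => v (t + -1) x) τ) x (curl ((fun t x => v (t + -1) x) τ) x) -
        fderiv ℝ (curl ((fun t x => v (t + -1) x) τ)) x ((fun t x => v (t + -1) x) τ x)‖ ≤ φ τ := by
    intro τ hτ x
    have h := hA (τ + -1) (by linarith) x
    rw [show -(τ + -1) = 1 - τ by ring] at h
    rwa [hφ_eq τ hτ.le]
  -- the budget: `‖ω_w(t,x)‖ ≤ ∫_{(−∞,t]} φ = A (1-t)^{1-p}/(p-1)`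
  have hω : ∀ t < 0, ∀ x : EuclideanSpace ℝ (Fin 3),
      ‖curl ((fun t x => v (t + -1) x) t) x‖ ≤ A / (p - 1) * (1 - t) ^ (-(p - 1)) := by
    intro t ht x
    have hint : IntegrableOn φ (Iic t) := by
      have h : IntegrableOn (fun τ : ℝ => A * (1 - τ) ^ (-p)) (Iic t) :=
        (integrableOn_one_sub_rpow_neg_Iic_of_nonpos (q := p) (by linarith) ht.le).const_mul A
      exact IntegrableOn.congr_fun h (fun τ hτ => (hφ_eq τ ((mem_Iic.1 hτ).trans ht.le)).symm)
        measurableSet_Iic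
    have h := norm_curl_le_integral_Iic_of_commutator_majorant hwc hwK hwd hwm hφc hφ ht hint x
    have hval : ∫ τ in Iic t, φ τ = A * (1 - t) ^ (1 - p) / (p - 1) := by
      rw [← integral_Iic_one_sub_rpow_neg (q := p) (by linarith) ht.le A]
      exact setIntegral_congr_fun measurableSet_Iic fun τ hτ => hφ_eq τ ((mem_Iic.1 hτ).trans ht.le)
    calc ‖curl ((fun t x => v (t + -1) x) t) x‖ ≤ ∫ τ in Iic t, φ τ := h
      _ = A / (p - 1) * (1 - t) ^ (-(p - 1)) := by rw [hval, neg_sub]; ring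
  obtain ⟨b, hb⟩ := const_of_vorticity_polynomial_decay_shifted hwc hwK hwd hwm (β := p - 1) (by linarith) hω
  have hb' : ∀ τ < -1, ∀ x, v τ x = b := fun τ hτ x => by
    have h := hb (τ + 1) (by linarith) x
    simp only [show τ + 1 + -1 = τ by ring] at h
    exact h
  exact ⟨b, TypeILiouvilleStrainLedger.classP_const_of_const_below hc hK hm hb'⟩

/-- The same with the hypothesis on the CURL OF THE LAMB VECTOR: `‖curl(v × curl v)(τ,x)‖ ≤ A (−τ)^{−p}` on
`(−∞,0) × ℝ³` for some `p > 5` ⟹ ONE CONSTANT VECTOR. [cite: MajdaBertozziCUP2002, §1.1, §2.3]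
[cite: KochNadirashviliSereginSverak2009, §4 (i) (arXiv:0709.3599)] -/
theorem const_of_lambCurl_polynomial_decay
    {v : ℝ → EuclideanSpace ℝ (Fin 3) → EuclideanSpace ℝ (Fin 3)}
    (hc : ContinuousOn (uncurry v) (Iio 0 ×ˢ univ))
    (hK : ∃ K : ℝ, ∀ t < 0, ∀ x, ‖v t x‖ ≤ K)
    (hd : ∀ t < 0, IsWeaklyDivFree (v t))
    (hm : ∀ s t : ℝ, s < t → t < 0 → ∀ x,
      v t x = heatExtension (v s) (t - s) x - oseenDuhamel 1 s v v t x)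
    {p A : ℝ} (hp : 5 < p)
    (hlamb : ∀ τ < 0, ∀ x : EuclideanSpace ℝ (Fin 3),
      ‖curl (fun y => cross (v τ y) (curl (v τ) y)) x‖ ≤ A * (-τ) ^ (-p)) :
    ∃ b : EuclideanSpace ℝ (Fin 3), ∀ t < 0, ∀ x, v t x = b := by
  obtain ⟨K, hKb⟩ := hK
  obtain ⟨hsm', -⟩ := smooth_and_bounds_of_bounded_ancient_oseenMild hc hd hm hKb
  have hsm : IsSmoothSpaceTimeOn (Iio 0) v := hsm'
  have hslice : ∀ τ < 0, ContDiff ℝ 2 (v τ) := fun τ hτ =>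
    (hsm.contDiff_slice (mem_Iio.2 hτ)).of_le (by norm_cast)
  have hdiv' : ∀ τ < 0, VectorCalculus.IsDivFree (v τ) := fun τ hτ =>
    (hd τ hτ).isDivFree_of_contDiff ((hslice τ hτ).of_le (by norm_num))
  refine const_of_commutator_polynomial_decay hc ⟨K, hKb⟩ hd hm (A := A) hp fun τ hτ x => ?_
  rw [← TypeILiouvilleGeneralizedBeltrami.curl_lamb_eq_sub (hslice τ hτ) (hdiv' τ hτ) x]
  exact hlamb τ hτ x

end Summit.NavierStokesRegularity.NavierStokesRegularity.Theorems.TypeILiouvilleLambTail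

end
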